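import Summits.QuantumFields.BalabanUV.Beta.KernelWardRelative
import Summits.QuantumFields.BalabanUV.Beta.D1BFx.CoProjDivergence

/-!
# `BalabanUV.Beta.D1BFx.FineHessianWardRelative` — road «FP» ∕ «BF-x» for binder row D1, sub-leaf N3-fine-REL (part 2 of 3): THE WARD ROWS `hrow`
# (AND FIRST-BOND TRANSVERSALITY) OF THE FINE HESSIAN KERNEL FROM RELATIVE-INVERSE SOCKETS, and the PURE-GAUGE VERTEX OF A
# `Πᵀ`-DRESSED STENCIL FAMILY turned into (W1′) at every fine site (part 1 `D1BFx/CoProjDivergence`: it is supported on the base points)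

HONEST DEPENDENCY (page 1, mandatory): continuum YM on T⁴ ⇐ BetaPertH ∧ nine spine estimates (0/9 proved); BetaPertH ⇐ (D1) ∧ (D4) ∧
CAP+tail; G-an2-4 gates asym, D1 and NE2/3/4.  HONEST FRAMING (cell contract, verbatim): «discharging `BetaPertH` makes Bałaban's UV
stability UNCONDITIONAL — a real constructive-QFT result; it is NOT the continuum limit and NOT the Clay problem.»  No definition, no
`def … : Prop`, nothing cited, no printed statement as hypothesis; 0 binders of row D1 (hW ∕ hR ∕ D1Tel ∕ D1Rep) touched; nothing of D1 ∕
BetaPertH discharged.  [folklore] bookkeeping BY NAME over the tree.  ABSOLUTE RULE (cell charter, verbatim): «No internally-minted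
statement may enter as a cited fact. Every hypothesis is either kernel-proved in this package or a verbatim quotation of a PUBLISHED
theorem with page reference. The manuscript(s) under audit are NOT citable for their own disputed steps — they are the thing under
adjudication; programme-internal (2001/route/tribunal) claims are never citable.»

WHY.  Road FP's REP∞ chain of record (`FP/PerfectFullSandwich.secondMoment_TPerfOf_perfect_eq`, `FP/PerfectRepBasePoint…`,
`FP/RepSeam.hrep_perfect_of_rows`) carries the WARD ROWS `hrow : ∀ κ′ λ′ b, HasSum (fineHessA (axDressK n K) (coProj n S) Wf κ′ λ′ b) 0`
of the FULL fine kernel at the DRESSED letters (owner d1-p3's row N3-fine, `REP-DESIGN.md` (P1)).  This lineage's gen-2 supplier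
`FineHessianWard.hasSum_row_fineHessA_of_wardLaws` asks (W1) in the TWO-SIDED-INVERSE shape `(A ∘ divV S u) ∘ A = A∘X u − X u∘A`,
which a dressed resolvent `Π K Π` does not have (an1's `KernelWardRelative`: only a RELATIVE inverse `RelInv A 𝕄 E`), and at
EVERY fine site `u` — whereas the pure-gauge vertex of a `Πᵀ`-dressed stencil family vanishes off the base points (part 1).  This file
re-derives `hrow` from the sockets the dressed family CAN satisfy, and computes the dressed stencil's pure-gauge vertex exactly.

CONTENT.
* §1 [folklore] **`divFree_fineHessA_of_relWard`** (an1's `KernelWardRelative.ward_hess_conj_rel` at `D := 4`, blocking `1`, read through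
  `FineHessianReflection.fineHessA_eq_hess`): `RelInv A 𝕄 E`, (W1′) `divV S u = conjV 𝕄 (X u)`, (W2♮) `divW Wf u ν u′ =
  conjW 𝕄 0 (S ν u′) (X u) 0 (X₂ u ν u′) + N u ν u′`, tadpole-null `N`, `X`∕`X₂` localised commuting with `E` ⟹ first-bond
  divergence-freeness of `fineHessA A S Wf`; **`hasSum_row_fineHessA_of_relWard`** (= `hrow`, via gen-2's `hasSum_col_of_divFree` +
  `hasSum_row_of_col` for a symmetric table).
* §2 [folklore] `conjV_smul`; **`divV_coProj_eq_conjV`**: the BLOCK-STENCIL WARD LAW `cH • Σ_{v∈box} divV S (n•y + v) = conjV 𝕄 (Xc y)`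
  (an1's socket `hSd` of `KernelWardRelative.divV_vertexOfK_eq_conjV`; the shape discharged for the recursive wall family by leaf-10's
  `WardLocusRecursive.hSd_SrecAt`) gives (W1′) for `coProj n S` at EVERY fine site with the BASE-POINT-SUPPORTED generator
  `X′ u := [n•blk n u = u] · cH⁻¹ • Xc (blk n u)` (part 1's `CoProjDivergence.divV_coProj`); `loc_baseGen`, `comp_baseGen_comm`.
* §3 [folklore] ENDs **`divFree_fineHessA_coProj_of_letters`** ∕ **`hasSum_row_fineHessA_coProj_of_letters`** (`d + 1 = 4`, `Fib 3`):
  `hrow` for `fineHessA A (coProj n S) Wf` ⟸ {`RelInv A 𝕄 E`, block-stencil Ward law of `S`, (W2♮) of `Wf` against `X′`, tadpole-null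
  remainder, `E`-commutation, class data}.  The instance `A := axDressK n K` and the perfect resolvent are part 3 `FP/PerfectFineWard`.
NOT HERE: that Bałaban's ∕ road FP's letters satisfy these sockets (the letters are HYPOTHESES: K-side relative-inverse structure =
N0b∕X1 words, S∕W-side = the jet-level Ward identities and their inheritance to the perfect limit, N3(ii)–(iv)); any rooted variant; any estimate.  Unit `b2b-balaban-beta-d1-formalise-leaf-01` (gen 5), 2026-08-20.
-/

noncomputable section

namespace Summit.QuantumFields.BalabanUV.Beta.D1BFx.FineHessianWardRelative

open Finset
open scoped BigOperators
open Literature.MathematicalPhysics.QuantumFieldTheory.Balaban1983to89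
open Literature.MathematicalPhysics.QuantumFieldTheory.Balaban1983to89.Beta
open AffineAveraging (Form0 Form1 box toSite)
open AveragingContours (blk off off_mem_box blk_block blk_add_off grad)
open AxialProjector (coProj)
open Summit.QuantumFields.BalabanUV.Beta.D1BFx.CoProjDivergence (divV_coProj)

/-! ## §1 First-bond divergence-freeness and the Ward rows `hrow` of the fine Hessian kernel from RELATIVE-INVERSE sockets -/

section RelWard

open ExpKernelCalculus (Site MKer Decays BiLoc comp tadpole hess)
open DecimatedMomentSummable (AbsMoment₂)
open KernelWard (divV divW)
open B6BondElimination (unitVec)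
open Summit.QuantumFields.BalabanUV.Beta.TameKernelCalculus
open Summit.QuantumFields.BalabanUV.Beta.ChartConjugation (conjV conjW loc_conjW)
open Summit.QuantumFields.BalabanUV.Beta.ChartConjugationRelative (RelInv)
open Summit.QuantumFields.BalabanUV.Beta.KernelWardRelative (ward_hess_conj_rel conjV_zero loc_zero comp_zero_left)
open Summit.QuantumFields.BalabanUV.Beta.D1BFx.MomentTransferPeriodic (baseKer)
open Summit.QuantumFields.BalabanUV.Beta.D1BFx.ReducedKernelSandwichLeg (fineHessA absMoment₂_baseKer_fineHessA fineHessA_transpose)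
open Summit.QuantumFields.BalabanUV.Beta.D1BFx.FineHessianReflection (fineHessA_eq_hess)
open Summit.QuantumFields.BalabanUV.Beta.D1BFx.FineHessianWard (hasSum_col_of_divFree hasSum_row_of_col)

variable {F : Type*} [Fintype F]
variable {A M E : MKer 4 F} {S : Fin 4 → Site 4 → MKer 4 F} {Wf : Fin 4 → Site 4 → Fin 4 → Site 4 → MKer 4 F} {Cs C2 δ : ℝ}
  {X : Site 4 → MKer 4 F} {X₂ Nr : Site 4 → Fin 4 → Site 4 → MKer 4 F}

/-- [folklore] **FIRST-BOND TRANSVERSALITY OF THE FINE HESSIAN KERNEL FROM RELATIVE-INVERSE SOCKETS** (an1's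
`KernelWardRelative.ward_hess_conj_rel` at blocking `1`, read through `FineHessianReflection.fineHessA_eq_hess`).  Leg `A`, chart
operator `𝕄`, idempotent-like `E` with `RelInv A 𝕄 E` (`E∘A = A = A∘E`, `(A∘𝕄)∘E = E = (E∘𝕄)∘A` — the shape a DRESSED resolvent
`Π K Π` has, NOT a two-sided inverse); stencils and tables bi-localised; a generator family `X u` and a contact family `X₂ u ν u′`
localised and commuting with `E`; a localised TADPOLE-NULL remainder `N u ν u′`; and the jet laws at EVERY fine site `u`
(W1′) `divV S u = conjV 𝕄 (X u)`, (W2♮) `divW Wf u ν u′ = conjW 𝕄 0 (S ν u′) (X u) 0 (X₂ u ν u′) + N u ν u′`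
⟹ `Σ_{κ′} (fineHessA κ′ λ′ (u − e_{κ′}) u′ − fineHessA κ′ λ′ u u′) = 0`. -/
theorem divFree_fineHessA_of_relWard (hA : Spr A) (hM : Spr M) (hE : Spr E) (hR : RelInv A M E)
    (hS : ∀ κ' u, BiLoc (S κ' u) u u Cs δ) (hW : ∀ κ' u l' u', BiLoc (Wf κ' u l' u') u u' C2 δ) (hδ : 0 < δ)
    (hX : ∀ u, Loc (X u)) (hX₂ : ∀ u ν u', Loc (X₂ u ν u')) (hNr : ∀ u ν u', Loc (Nr u ν u'))
    (hEX : ∀ u, comp E (X u) = comp (X u) E) (hEX₂ : ∀ u ν u', comp E (X₂ u ν u') = comp (X₂ u ν u') E)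
    (hVd : ∀ u, divV S u = conjV M (X u))
    (hWd : ∀ u ν u', divW Wf u ν u' = conjW M 0 (S ν u') (X u) 0 (X₂ u ν u') + Nr u ν u')
    (hN0 : ∀ u ν u', tadpole A (Nr u ν u') = 0) (l' : Fin 4) (u' u : Site 4) :
    ∑ κ' : Fin 4, (fineHessA A S Wf κ' l' (u - unitVec κ') u' - fineHessA A S Wf κ' l' u u') = 0 := by
  have hSl : ∀ κ' u, Loc (S κ' u) := fun κ' u => ⟨u, u, Cs, δ, hδ, hS κ' u⟩
  have hWl : ∀ κ' u l' u', Loc (Wf κ' u l' u') := fun κ' u l' u' => ⟨u, u', C2, δ, hδ, hW κ' u l' u'⟩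
  have h := ward_hess_conj_rel hA hM hE hR hSl hWl hX hX₂ hNr hEX hEX₂ hVd hWd hN0 u l' u'
  simpa only [fineHessA_eq_hess] using h

variable [Nonempty F]

/-- [folklore] **THE WARD ROWS `hrow` OF THE FINE HESSIAN KERNEL FROM RELATIVE-INVERSE SOCKETS** (plus matrix symmetry, for a SYMMETRIC
table): `∀ κ′ λ′ b, HasSum (fineHessA A S Wf κ′ λ′ b) 0` — the `hrow` binder shape of the A4 ∕ K-R5 ∕ REP∞ ENDs
(`FineHessianWard.bondSecondMoment_TOfLeg_eq_avgM2_of_laws`, `FP/PerfectFullSandwich.secondMoment_TPerfOf_perfect_eq`,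
`FP/RepSeam.hrep_perfect_of_rows`), now from the sockets a dressed resolvent CAN satisfy. -/
theorem hasSum_row_fineHessA_of_relWard (hA : Spr A) (hM : Spr M) (hE : Spr E) (hR : RelInv A M E)
    (hS : ∀ κ' u, BiLoc (S κ' u) u u Cs δ) (hW : ∀ κ' u l' u', BiLoc (Wf κ' u l' u') u u' C2 δ) (hδ : 0 < δ)
    (hWsymm : ∀ (κ' : Fin 4) (u : Site 4) (l' : Fin 4) (u' : Site 4), Wf κ' u l' u' = Wf l' u' κ' u)
    (hX : ∀ u, Loc (X u)) (hX₂ : ∀ u ν u', Loc (X₂ u ν u')) (hNr : ∀ u ν u', Loc (Nr u ν u'))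
    (hEX : ∀ u, comp E (X u) = comp (X u) E) (hEX₂ : ∀ u ν u', comp E (X₂ u ν u') = comp (X₂ u ν u') E)
    (hVd : ∀ u, divV S u = conjV M (X u))
    (hWd : ∀ u ν u', divW Wf u ν u' = conjW M 0 (S ν u') (X u) 0 (X₂ u ν u') + Nr u ν u')
    (hN0 : ∀ u ν u', tadpole A (Nr u ν u') = 0) (κ' l' : Fin 4) (b : Site 4) :
    HasSum (fineHessA A S Wf κ' l' b) 0 :=
  hasSum_row_of_col (fun κ₁ l₁ u u' => fineHessA_transpose A hA hS hδ hWsymm κ₁ l₁ u u')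
    (hasSum_col_of_divFree (divFree_fineHessA_of_relWard hA hM hE hR hS hW hδ hX hX₂ hNr hEX hEX₂ hVd hWd hN0)
      (absMoment₂_baseKer_fineHessA A hA hS hW hδ)) κ' l' b

end RelWard

/-! ## §2 The dressed stencil `coProj n S`: (W1′) at every fine site from the BLOCK-STENCIL Ward law -/

section Dressed

open ExpKernelCalculus (Site MKer Decays BiLoc comp tadpole hess)
open DecimatedMomentSummable (AbsMoment₂)
open KernelWard (divV divW)
open B6BondElimination (unitVec)
open Summit.QuantumFields.BalabanUV.Beta.TameKernelCalculus
open Summit.QuantumFields.BalabanUV.Beta.ChartConjugation (conjV conjW loc_conjW)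
open Summit.QuantumFields.BalabanUV.Beta.ChartConjugationRelative (RelInv)
open Summit.QuantumFields.BalabanUV.Beta.KernelWardRelative (ward_hess_conj_rel conjV_zero loc_zero comp_zero_left)
open StepDriftWitness (comp_zero_right)
open AxialDressing (locStencil_coProj cN')
open OneStepResolventKernel (LocStencil)
open Summit.QuantumFields.BalabanUV.Beta.D1BFx.MomentTransferPeriodic (baseKer)
open Summit.QuantumFields.BalabanUV.Beta.D1BFx.ReducedKernelSandwichLeg (fineHessA absMoment₂_baseKer_fineHessA fineHessA_transpose)

variable {D : ℕ} {F : Type*} [Fintype F]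

/-- [folklore] `conjV 𝕄` is homogeneous in the generator. -/
theorem conjV_smul (M X : MKer D F) (c : ℝ) : conjV M (c • X) = c • conjV M X := by
  unfold ChartConjugation.conjV
  rw [KernelReflection.comp_smul_right, KernelReflection.comp_smul_left, smul_sub]

/-- [folklore] **(W1′) FOR THE `Πᵀ`-DRESSED STENCIL AT EVERY FINE SITE.**  If the undressed family `S` satisfies the BLOCK-STENCIL WARD
LAW WITH CONTACT `cH • Σ_{v ∈ box} divV S (n•y + v) = conjV 𝕄 (Xc y)` at every coarse site `y` (an1's `hSd` socket shape of
`KernelWardRelative.divV_vertexOfK_eq_conjV`; discharged for the recursive wall family by leaf-10's `WardLocusRecursive.hSd_SrecAt`),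
`cH ≠ 0`, then the dressed family obeys (W1′) at EVERY fine site `u` with the BASE-POINT-SUPPORTED generator
`X′ u := [n • blk n u = u] · cH⁻¹ • Xc (blk n u)` (`divV_coProj`). -/
theorem divV_coProj_eq_conjV {n : ℕ} (hn : 1 ≤ n) {S : Fin D → Site D → MKer D F} {M : MKer D F} {Xc : Site D → MKer D F}
    {cH : ℝ} (hcH : cH ≠ 0)
    (hSd : ∀ y : Site D, cH • ∑ v ∈ box D n, divV S ((n : ℤ) • y + toSite v) = conjV M (Xc y)) (u : Site D) :
    divV (coProj n S) u = conjV M (if (n : ℤ) • blk n u = u then cH⁻¹ • Xc (blk n u) else 0) := by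
  rw [divV_coProj hn]
  split_ifs with h
  · have h1 := hSd (blk n u)
    rw [h] at h1
    rw [conjV_smul, ← h1, smul_smul, inv_mul_cancel₀ hcH, one_smul]
  · rw [conjV_zero]

omit [Fintype F] in
/-- [folklore] The base-point-supported generator is localised if `Xc` is. -/
theorem loc_baseGen {n : ℕ} {Xc : Site D → MKer D F} (hXc : ∀ y, Loc (Xc y)) (cH : ℝ) (u : Site D) :
    Loc (if (n : ℤ) • blk n u = u then cH⁻¹ • Xc (blk n u) else 0 : MKer D F) := by
  split_ifs
  · exact (hXc _).smul _
  · exact loc_zero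

/-- [folklore] The base-point-supported generator commutes with `E` if `Xc` does. -/
theorem comp_baseGen_comm {n : ℕ} {E : MKer D F} {Xc : Site D → MKer D F} (hEXc : ∀ y, comp E (Xc y) = comp (Xc y) E) (cH : ℝ)
    (u : Site D) :
    comp E (if (n : ℤ) • blk n u = u then cH⁻¹ • Xc (blk n u) else 0 : MKer D F)
      = comp (if (n : ℤ) • blk n u = u then cH⁻¹ • Xc (blk n u) else 0 : MKer D F) E := by
  split_ifs
  · rw [KernelReflection.comp_smul_right, KernelReflection.comp_smul_left, hEXc]
  · rw [comp_zero_right, comp_zero_left]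

end Dressed

/-! ## §3 ENDs: first-bond divergence-freeness and `hrow` of `fineHessA A (coProj n S) Wf` from LETTERS -/

section Letters

open ExpKernelCalculus (Site MKer Decays BiLoc comp tadpole hess)
open DecimatedMomentSummable (AbsMoment₂)
open KernelWard (divV divW)
open B6BondElimination (unitVec)
open Summit.QuantumFields.BalabanUV.Beta.TameKernelCalculus
open Summit.QuantumFields.BalabanUV.Beta.ChartConjugation (conjV conjW loc_conjW)
open Summit.QuantumFields.BalabanUV.Beta.ChartConjugationRelative (RelInv)
open AxialDressing (locStencil_coProj cN')
open OneStepResolventKernel (LocStencil)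
open Summit.QuantumFields.BalabanUV.Beta.D1BFx.MomentTransferPeriodic (baseKer)
open Summit.QuantumFields.BalabanUV.Beta.D1BFx.ReducedKernelSandwichLeg (fineHessA absMoment₂_baseKer_fineHessA fineHessA_transpose)

variable {A M E : MKer (3 + 1) (OneStepResolventKernel.Fib 3)} {n : ℕ}
  {S : Fin (3 + 1) → (Fin (3 + 1) → ℤ) → MKer (3 + 1) (OneStepResolventKernel.Fib 3)} {Cs δs : ℝ}
  {Wf : Fin (3 + 1) → (Fin (3 + 1) → ℤ) → Fin (3 + 1) → (Fin (3 + 1) → ℤ) → MKer (3 + 1) (OneStepResolventKernel.Fib 3)} {C2 δ2 : ℝ}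
  {Xc : (Fin (3 + 1) → ℤ) → MKer (3 + 1) (OneStepResolventKernel.Fib 3)} {cH : ℝ}
  {X₂ Nr : (Fin (3 + 1) → ℤ) → Fin (3 + 1) → (Fin (3 + 1) → ℤ) → MKer (3 + 1) (OneStepResolventKernel.Fib 3)}

/-- [folklore] **FIRST-BOND TRANSVERSALITY OF THE `Πᵀ`-DRESSED FINE HESSIAN KERNEL FROM LETTERS** (`d + 1 = 4`, packed fibre `Fib 3`,
blocking `n ≥ 1`).  LETTERS: the relative-inverse structure `RelInv A 𝕄 E` of the leg; the local stencil family `S` with its BLOCK-STENCIL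
WARD LAW `cH • Σ_{v∈box} divV S (n•y + v) = conjV 𝕄 (Xc y)` (`cH ≠ 0`, `Xc` localised, commuting with `E`); the bi-localised table `Wf`
with the second-order law (W2♮) `divW Wf u ν u′ = conjW 𝕄 0 (coProj n S ν u′) (X′ u) 0 (X₂ u ν u′) + N u ν u′` against the
base-point-supported generator `X′ u := [n•blk n u = u] · cH⁻¹ • Xc (blk n u)`, `X₂` localised commuting with `E`, `N` localised and
tadpole-null ⟹ `Σ_{κ′} (fineHessA A (coProj n S) Wf κ′ λ′ (u − e_{κ′}) u′ − fineHessA … κ′ λ′ u u′) = 0` at EVERY fine site `u`. -/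
theorem divFree_fineHessA_coProj_of_letters (hn : 1 ≤ n) (hA : Spr A) (hM : Spr M) (hE : Spr E) (hR : RelInv A M E)
    (hS : LocStencil S Cs δs) (hδs : 0 < δs) (hW : ∀ κ' u l' u', BiLoc (Wf κ' u l' u') u u' C2 δ2) (hδ2 : 0 < δ2)
    (hcH : cH ≠ 0) (hXc : ∀ y, Loc (Xc y)) (hEXc : ∀ y, comp E (Xc y) = comp (Xc y) E)
    (hSd : ∀ y : Fin (3 + 1) → ℤ, cH • ∑ v ∈ box (3 + 1) n, divV S ((n : ℤ) • y + toSite v) = conjV M (Xc y))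
    (hX₂ : ∀ u ν u', Loc (X₂ u ν u')) (hEX₂ : ∀ u ν u', comp E (X₂ u ν u') = comp (X₂ u ν u') E)
    (hNr : ∀ u ν u', Loc (Nr u ν u')) (hN0 : ∀ u ν u', tadpole A (Nr u ν u') = 0)
    (hWd : ∀ u ν u', divW Wf u ν u' = conjW M 0 (coProj n S ν u')
      (if (n : ℤ) • blk n u = u then cH⁻¹ • Xc (blk n u) else 0) 0 (X₂ u ν u') + Nr u ν u')
    (l' : Fin (3 + 1)) (u' u : Fin (3 + 1) → ℤ) :
    ∑ κ' : Fin (3 + 1), (fineHessA A (coProj n S) Wf κ' l' (u - unitVec κ') u' - fineHessA A (coProj n S) Wf κ' l' u u') = 0 := by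
  have hm : 0 < min δs δ2 := lt_min hδs hδ2
  have hS' : ∀ κ u, BiLoc (coProj n S κ u) u u (|cN' 3 n δs * Cs|) (min δs δ2) := fun κ u =>
    biLoc_of_le (locStencil_coProj hn hS hδs.le κ u) (min_le_left _ _)
  have hW' : ∀ κ' u l' u', BiLoc (Wf κ' u l' u') u u' (|C2|) (min δs δ2) := fun κ' u l' u' =>
    biLoc_of_le (hW κ' u l' u') (min_le_right _ _)
  exact divFree_fineHessA_of_relWard hA hM hE hR hS' hW' hm (fun u => loc_baseGen hXc cH u) hX₂ hNr
    (fun u => comp_baseGen_comm hEXc cH u) hEX₂ (fun u => divV_coProj_eq_conjV hn hcH hSd u) hWd hN0 l' u' u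

/-- [folklore] **THE WARD ROWS `hrow` OF THE `Πᵀ`-DRESSED FINE HESSIAN KERNEL FROM LETTERS** (symmetric table): the `hrow` binder of
`FP/PerfectFullSandwich.bondSecondMoment_TPerfOf_eq_avgM2` ∕ `secondMoment_TPerfOf_vertex2OfK_eq` at a GENERIC dressed leg
`A` (for `A := axDressK n K` see `FP/PerfectFineWard`), reduced to the letters of `divFree_fineHessA_coProj_of_letters`. -/
theorem hasSum_row_fineHessA_coProj_of_letters (hn : 1 ≤ n) (hA : Spr A) (hM : Spr M) (hE : Spr E) (hR : RelInv A M E)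
    (hS : LocStencil S Cs δs) (hδs : 0 < δs) (hW : ∀ κ' u l' u', BiLoc (Wf κ' u l' u') u u' C2 δ2) (hδ2 : 0 < δ2)
    (hWsymm : ∀ (κ' : Fin 4) (u : Fin (3 + 1) → ℤ) (l' : Fin 4) (u' : Fin (3 + 1) → ℤ), Wf κ' u l' u' = Wf l' u' κ' u)
    (hcH : cH ≠ 0) (hXc : ∀ y, Loc (Xc y)) (hEXc : ∀ y, comp E (Xc y) = comp (Xc y) E)
    (hSd : ∀ y : Fin (3 + 1) → ℤ, cH • ∑ v ∈ box (3 + 1) n, divV S ((n : ℤ) • y + toSite v) = conjV M (Xc y))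
    (hX₂ : ∀ u ν u', Loc (X₂ u ν u')) (hEX₂ : ∀ u ν u', comp E (X₂ u ν u') = comp (X₂ u ν u') E)
    (hNr : ∀ u ν u', Loc (Nr u ν u')) (hN0 : ∀ u ν u', tadpole A (Nr u ν u') = 0)
    (hWd : ∀ u ν u', divW Wf u ν u' = conjW M 0 (coProj n S ν u')
      (if (n : ℤ) • blk n u = u then cH⁻¹ • Xc (blk n u) else 0) 0 (X₂ u ν u') + Nr u ν u')
    (κ' l' : Fin (3 + 1)) (b : Fin (3 + 1) → ℤ) :
    HasSum (fineHessA A (coProj n S) Wf κ' l' b) 0 := by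
  have hm : 0 < min δs δ2 := lt_min hδs hδ2
  have hS' : ∀ κ u, BiLoc (coProj n S κ u) u u (|cN' 3 n δs * Cs|) (min δs δ2) := fun κ u =>
    biLoc_of_le (locStencil_coProj hn hS hδs.le κ u) (min_le_left _ _)
  have hW' : ∀ κ' u l' u', BiLoc (Wf κ' u l' u') u u' (|C2|) (min δs δ2) := fun κ' u l' u' =>
    biLoc_of_le (hW κ' u l' u') (min_le_right _ _)
  exact hasSum_row_fineHessA_of_relWard hA hM hE hR hS' hW' hm hWsymm (fun u => loc_baseGen hXc cH u) hX₂ hNr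
    (fun u => comp_baseGen_comm hEXc cH u) hEX₂ (fun u => divV_coProj_eq_conjV hn hcH hSd u) hWd hN0 κ' l' b

end Letters

end Summit.QuantumFields.BalabanUV.Beta.D1BFx.FineHessianWardRelative

end
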